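import Literature.Algebra.Homology.DiscreteRepExtInternalHom
import Literature.Algebra.Homology.DiscreteRepStandardResolutionNaturality
import HarnessLib

/-!
# Naturality IN THE COEFFICIENTS `X` of `Extⁿ_{C_Γ}(N, X) ≃+ Extⁿ_{C_Γ}(triv k, Hom(N, X)) ≃+ Hⁿ_cont(Γ, Hom(N, X))`
# (Harari Prop. 16.16 / Lemma 17.21 (a): functoriality of `Extʳ_G(N, P) = Hʳ(G, Hom(N, P))` in `P`)

Topic `Algebra/Homology`; namespace `Literature.Algebra.Homology.DiscreteRep`.  One abbreviation (the cochain map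
`Hom(N, std• f)`) and theorems; no named fact, no instance, no notation, no `sorry`.  Sequel of door-c4's `DiscreteRepInternalHom` / `DiscreteRepExtInternalHom` (the
comparison `extIhomAddEquiv N X hX hN n` and `extIhomAddEquivContinuousCohomology`; "Not here (sequels): naturality in `X`
and in `N`"), of `DiscreteRepExtInternalHomPrecomp` (bsd-eis -w7 g12: naturality in `N`), of `ExtOfAcyclicResolutionNaturality`
(door-c4: naturality of the engine in the resolution) and `DiscreteRepStandardResolutionNaturality` (door-c4: `stdComplexMap`,
`stdη_naturality`, `extTrivAddEquivContinuousCohomology_naturality`).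

THE MATHEMATICS.  For a morphism `f : X ⟶ X'` of topologically discrete representations of the compact group `Γ` with open
stabilisers and `N ∈ C_Γ` finitely generated, post-composition `f_* : Extⁿ(N, X) → Extⁿ(N, X')` corresponds, under the
comparison of Harari Prop. 16.16 (b) / Milne I 0.8 / Harari Lemma 17.21 (a), to `Hom(N, f)_*` on `Extⁿ(triv k, Hom(N, ·))` and to
`Hⁿ(Hom(N, f))` on continuous cohomology — "these isomorphisms are functorial" (Harari §16.2 (16.4)).  The three constituents are
natural separately, each along door-c4's cochain map `stdComplexMap f` of standard complexes: the engine on `std• X` (door-c4's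
naturality in the resolution at the module `N`), the curry isomorphism of `Ext⁰`-complexes (`curryExt₀_comp_mk₀`:
`curry (x ∘ h) = curry x ∘ Hom(N, h)`), and the engine on the `Hom` complexes along `Hom(N, std• f)`.

MAIN RESULTS: **`extIhomAddEquiv_postcomp`**: `extIhomAddEquiv N X' (x ∘ [f]) = (extIhomAddEquiv N X x) ∘ [Hom(N, f)]`;
**`extIhomAddEquivContinuousCohomology_postcomp`**: for discrete `Y ≅ Hom(N, X)`, `Y' ≅ Hom(N, X')` and `ψ : Y ⟶ Y'` matching
`Hom(N, f)` under the identifications, `Hⁿ(ψ) (cmp_X x) = cmp_{X'} (x ∘ [f])`.  Written for the background lane «PT-Ш-S-TC» of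
crux `stmt-BirchSwinnertonDyer-19032` (cell bsd-eis, seat bsd-line-x1-p1-w7 gen 12, brick D4a file C3): it is square (d) of the
seat's (Λ)-scoping memo (the compatibility of `cmp` with the coefficient maps `Ē_S → Ī_S → ·`).  HONEST FRAMING: homological
algebra only; no duality theorem and no case of BSD is proved here.  AI formalisation, established only by the kernel check.

## References
* D. Harari, *Galois Cohomology and Class Field Theory*, Universitext (2020), §16.2: Prop. 16.16 (p. 271), (16.4); Lemma 17.21 (a).
  [Harari2020]
* J. S. Milne, *Arithmetic Duality Theorems*, 2nd ed. (2006), I §0 (Example 0.8). [MilneADT2006]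
* C. A. Weibel, *An introduction to homological algebra* (1994), §2.7. [Weibel1994]
-/

noncomputable section

universe u

namespace Literature.Algebra.Homology

namespace DiscreteRep

open CategoryTheory CategoryTheory.Limits CategoryTheory.Abelian TopRep
open scoped _root_.Topology

variable {k Γ : Type u} [CommRing k] [TopologicalSpace k] [Group Γ] [TopologicalSpace Γ]
  [IsTopologicalGroup Γ]

/-! ## §1 The curry isomorphism of `Ext⁰`-complexes is natural in the complex -/

section Curry

variable (N : DiscreteRepCat k Γ) [Module.Finite k N.obj.V] {I I' : CochainComplex (DiscreteRepCat k Γ) ℕ} (φ : I ⟶ I')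

omit [TopologicalSpace k] in
/-- **`curry (x ∘ φ) = curry x ∘ Hom(N, φ)` on `Ext⁰`-complexes**: the curry isomorphisms intertwine `φ_*` with `Hom(N, φ)_*`.
[cite: Harari2020, §16.2, Theorem 16.14 (proof, (16.2)) and (16.4)] -/
theorem extComplexCurryIso_hom_naturality :
    AcyclicResolution.extComplexMap N φ ≫ (extComplexCurryIso N I').hom =
      (extComplexCurryIso N I).hom ≫ AcyclicResolution.extComplexMap (triv (Γ := Γ) k)
        (((ihomFunctor N).mapHomologicalComplex (ComplexShape.up ℕ)).map φ) := by
  refine HomologicalComplex.hom_ext _ _ fun n => ?_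
  ext x
  change curryExt₀ N (I'.X n) (x.comp (Ext.mk₀ (φ.f n)) (add_zero 0)) =
    (curryExt₀ N (I.X n) x).comp (Ext.mk₀ ((ihomFunctor N).map (φ.f n))) (add_zero 0)
  exact curryExt₀_comp_mk₀ N x (φ.f n)

omit [TopologicalSpace k] in
/-- Hence on homology. [cite: Harari2020, §16.2, Theorem 16.14 (proof, (16.2)) and (16.4)] -/
theorem extComplexCurryHomologyIso_hom_naturality (n : ℕ) :
    HomologicalComplex.homologyMap (AcyclicResolution.extComplexMap N φ) n ≫ (extComplexCurryHomologyIso N I' n).hom =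
      (extComplexCurryHomologyIso N I n).hom ≫
        HomologicalComplex.homologyMap (AcyclicResolution.extComplexMap (triv (Γ := Γ) k)
          (((ihomFunctor N).mapHomologicalComplex (ComplexShape.up ℕ)).map φ)) n := by
  change HomologicalComplex.homologyMap _ n ≫ HomologicalComplex.homologyMap _ n =
    HomologicalComplex.homologyMap _ n ≫ HomologicalComplex.homologyMap _ n
  rw [← HomologicalComplex.homologyMap_comp, ← HomologicalComplex.homologyMap_comp,
    extComplexCurryIso_hom_naturality]

end Curry

/-! ## §2 The comparison is natural in the coefficients -/

section Main

variable [CompactSpace Γ] (N : DiscreteRepCat k Γ) [Module.Finite k N.obj.V]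
  {X X' : TopRep.{u} k Γ} [DiscreteTopology X.V] [DiscreteTopology X'.V]
  (hX : IsDiscrete ((forgetTop k Γ).obj X)) (hX' : IsDiscrete ((forgetTop k Γ).obj X')) (f : X ⟶ X')

/-- The cochain map `Hom(N, std• f) : Hom(N, std• X) ⟶ Hom(N, std• X')` (an abbreviation: the expected type guides the
elaboration of door-c4's naturality engine below). [cite: Harari2020, §16.2, Theorem 16.14 (proof) and (16.4)] -/
abbrev ihomStdComplexMap : ihomStdComplex N X hX ⟶ ihomStdComplex N X' hX' :=
  ((ihomFunctor N).mapHomologicalComplex (ComplexShape.up ℕ)).map (stdComplexMap hX hX' f)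

/-- The augmentations of the `Hom` complexes are compatible with `Hom(N, f)`.
[cite: Harari2020, §16.2, Theorem 16.14 (proof) and (16.4)] -/
theorem ihomStdη_naturality :
    ihomStdη N X hX ≫ (ihomStdComplexMap N hX hX' f).f 0 =
      (ihomFunctor N).map (stdBaseMap hX hX' f) ≫ ihomStdη N X' hX' := by
  change (ihomFunctor N).map (stdη X hX) ≫ (ihomFunctor N).map ((stdComplexMap hX hX' f).f 0) =
    (ihomFunctor N).map (stdBaseMap hX hX' f) ≫ (ihomFunctor N).map (stdη X' hX')
  rw [← Functor.map_comp, ← Functor.map_comp, stdη_naturality]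

/-- **`extTrivIhomAddEquivHomology` is natural in `X`** (door-c4's naturality in the resolution along `Hom(N, std• f)`).
[cite: Harari2020, §16.2, Theorem 16.14 (proof) and (16.4)] -/
theorem extTrivIhomAddEquivHomology_naturality (n : ℕ) (y : Ext (triv (Γ := Γ) k) (ihomObj N (stdBase X hX)) n) :
    (HomologicalComplex.homologyMap (AcyclicResolution.extComplexMap (triv (Γ := Γ) k)
        (ihomStdComplexMap N hX hX' f)) n).hom (extTrivIhomAddEquivHomology N X hX n y) =
      extTrivIhomAddEquivHomology N X' hX' n
        (y.comp (Ext.mk₀ ((ihomFunctor N).map (stdBaseMap hX hX' f))) (add_zero n)) := by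
  haveI := mono_ihomStdη N X hX
  haveI := mono_ihomStdη N X' hX'
  cases n with
  | zero =>
    exact AcyclicResolution.extAddEquivHomologyZero_naturality (triv (Γ := Γ) k)
      (ihomStdComplexMap N hX hX' f) (ihomStdη N X hX) (ihomStdη_d N X hX) (exact_ihomStdη N X hX)
      (ihomStdη N X' hX') (ihomStdη_d N X' hX') (exact_ihomStdη N X' hX') ((ihomFunctor N).map (stdBaseMap hX hX' f))
      (ihomStdη_naturality N hX hX' f) y
  | succ n =>
    exact AcyclicResolution.extAddEquivHomologySucc_naturality (triv (Γ := Γ) k)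
      (ihomStdComplexMap N hX hX' f) (ihomStdη N X hX) (ihomStdη_d N X hX) (exact_ihomStdη N X hX)
      (ihomStdη N X' hX') (ihomStdη_d N X' hX') (exact_ihomStdη N X' hX') ((ihomFunctor N).map (stdBaseMap hX hX' f))
      (ihomStdη_naturality N hX hX' f) (ihomStdComplex_exactAt_succ N X hX)
      (ext_triv_ihomStdComplex_X_eq_zero N X hX) (ihomStdComplex_exactAt_succ N X' hX')
      (ext_triv_ihomStdComplex_X_eq_zero N X' hX') n y

variable (hN : ∀ n q (e : Ext N ((stdComplex X hX).X n) (q + 1)), e = 0)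
  (hN' : ∀ n q (e : Ext N ((stdComplex X' hX').X n) (q + 1)), e = 0)

omit [Module.Finite k N.obj.V] in
/-- **`extAddEquivStdHomology` is natural in `X`** (door-c4's naturality in the resolution along `std• f`, at the module `N`).
[cite: Harari2020, §16.2, Theorem 16.14 (proof) and (16.4)] -/
theorem extAddEquivStdHomology_naturality (n : ℕ) (x : Ext N (stdBase X hX) n) :
    (HomologicalComplex.homologyMap (AcyclicResolution.extComplexMap N (stdComplexMap hX hX' f)) n).hom
        (extAddEquivStdHomology N X hX hN n x) =
      extAddEquivStdHomology N X' hX' hN' n (x.comp (Ext.mk₀ (stdBaseMap hX hX' f)) (add_zero n)) := by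
  cases n with
  | zero =>
    exact AcyclicResolution.extAddEquivHomologyZero_naturality N (stdComplexMap hX hX' f) (stdη X hX) (stdη_d X hX)
      (exact_stdη X hX) (stdη X' hX') (stdη_d X' hX') (exact_stdη X' hX') (stdBaseMap hX hX' f)
      (stdη_naturality hX hX' f) x
  | succ n =>
    exact AcyclicResolution.extAddEquivHomologySucc_naturality N (stdComplexMap hX hX' f) (stdη X hX) (stdη_d X hX)
      (exact_stdη X hX) (stdη X' hX') (stdη_d X' hX') (exact_stdη X' hX') (stdBaseMap hX hX' f)
      (stdη_naturality hX hX' f) (stdComplex_exactAt_succ X hX) hN (stdComplex_exactAt_succ X' hX') hN' n x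

/-- **THE COMPARISON `Extⁿ_{C_Γ}(N, X) ≃+ Extⁿ_{C_Γ}(triv k, Hom(N, X))` IS NATURAL IN `X`**:
`extIhomAddEquiv N X' (x ∘ [f]) = (extIhomAddEquiv N X x) ∘ [Hom(N, f)]`.
[cite: Harari2020, §16.2, Proposition 16.16 and (16.4)][cite: MilneADT2006, I §0 Example 0.8] -/
theorem extIhomAddEquiv_postcomp (n : ℕ) (x : Ext N (stdBase X hX) n) :
    extIhomAddEquiv N X' hX' hN' n (x.comp (Ext.mk₀ (stdBaseMap hX hX' f)) (add_zero n)) =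
      (extIhomAddEquiv N X hX hN n x).comp (Ext.mk₀ ((ihomFunctor N).map (stdBaseMap hX hX' f))) (add_zero n) := by
  set E := extTrivIhomAddEquivHomology N X hX n with hE
  set E' := extTrivIhomAddEquivHomology N X' hX' n with hE'
  change E'.symm ((extComplexCurryHomologyIso N (stdComplex X' hX') n).addCommGroupIsoToAddEquiv
      (extAddEquivStdHomology N X' hX' hN' n (x.comp (Ext.mk₀ (stdBaseMap hX hX' f)) (add_zero n)))) =
    (E.symm ((extComplexCurryHomologyIso N (stdComplex X hX) n).addCommGroupIsoToAddEquiv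
      (extAddEquivStdHomology N X hX hN n x))).comp (Ext.mk₀ ((ihomFunctor N).map (stdBaseMap hX hX' f))) (add_zero n)
  rw [← extAddEquivStdHomology_naturality N hX hX' f hN hN' n x]
  have hsq := congrArg (fun g => g.hom (extAddEquivStdHomology N X hX hN n x))
    (extComplexCurryHomologyIso_hom_naturality N (stdComplexMap hX hX' f) n)
  change (extComplexCurryHomologyIso N (stdComplex X' hX') n).addCommGroupIsoToAddEquiv
      ((HomologicalComplex.homologyMap (AcyclicResolution.extComplexMap N (stdComplexMap hX hX' f)) n).hom
        (extAddEquivStdHomology N X hX hN n x)) =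
    (HomologicalComplex.homologyMap (AcyclicResolution.extComplexMap (triv (Γ := Γ) k)
        (ihomStdComplexMap N hX hX' f)) n).hom
      ((extComplexCurryHomologyIso N (stdComplex X hX) n).addCommGroupIsoToAddEquiv
        (extAddEquivStdHomology N X hX hN n x)) at hsq
  rw [hsq]
  apply E'.injective
  rw [AddEquiv.apply_symm_apply, ← extTrivIhomAddEquivHomology_naturality N hX hX' f n, AddEquiv.apply_symm_apply]

/-- **THE COMPARISON `Extⁿ_{C_Γ}(N, X) ≃+ Hⁿ_cont(Γ, Y)` (`Y ≅ Hom(N, X)`) IS NATURAL IN `X`**: for `f : X ⟶ X'`, discrete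
`Y ≅ Hom(N, X)`, `Y' ≅ Hom(N, X')` in `C_Γ` and a morphism `ψ : Y ⟶ Y'` that is `Hom(N, f)` under the identifications (`hψ`),
`Hⁿ(ψ) (cmp_X x) = cmp_{X'} (x ∘ [f])`. [cite: Harari2020, Lemma 17.21 (a) and §16.2 (16.4)][cite: MilneADT2006, I §0 Example 0.8] -/
theorem extIhomAddEquivContinuousCohomology_postcomp {Y Y' : TopRep.{u} k Γ} [DiscreteTopology Y.V]
    [DiscreteTopology Y'.V] (hY : IsDiscrete ((forgetTop k Γ).obj Y)) (hY' : IsDiscrete ((forgetTop k Γ).obj Y'))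
    (e : stdBase Y hY ≅ ihomObj N (stdBase X hX)) (e' : stdBase Y' hY' ≅ ihomObj N (stdBase X' hX'))
    (ψ : Y ⟶ Y') (hψ : stdBaseMap hY hY' ψ ≫ e'.hom = e.hom ≫ (ihomFunctor N).map (stdBaseMap hX hX' f))
    (n : ℕ) (x : Ext N (stdBase X hX) n) :
    (ContinuousCohomology.map (ContinuousMonoidHom.id Γ) (X := Y) (Y := Y') ψ n).hom
        (extIhomAddEquivContinuousCohomology N X hX hN Y hY e n x) =
      extIhomAddEquivContinuousCohomology N X' hX' hN' Y' hY' e' n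
        (x.comp (Ext.mk₀ (stdBaseMap hX hX' f)) (add_zero n)) := by
  have hψ' : e.inv ≫ stdBaseMap hY hY' ψ = (ihomFunctor N).map (stdBaseMap hX hX' f) ≫ e'.inv := by
    rw [Iso.inv_comp_eq, ← Category.assoc, ← hψ, Category.assoc, Iso.hom_inv_id, Category.comp_id]
  change (ContinuousCohomology.map (ContinuousMonoidHom.id Γ) (X := Y) (Y := Y') ψ n).hom
      (extTrivAddEquivContinuousCohomology Y hY n
        (AcyclicResolution.extAddEquivOfIso (triv k) e.symm n (extIhomAddEquiv N X hX hN n x))) =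
    extTrivAddEquivContinuousCohomology Y' hY' n
      (AcyclicResolution.extAddEquivOfIso (triv k) e'.symm n
        (extIhomAddEquiv N X' hX' hN' n (x.comp (Ext.mk₀ (stdBaseMap hX hX' f)) (add_zero n))))
  rw [extTrivAddEquivContinuousCohomology_naturality hY hY' ψ n, extIhomAddEquiv_postcomp N hX hX' f hN hN' n x,
    AcyclicResolution.extAddEquivOfIso_apply, AcyclicResolution.extAddEquivOfIso_apply, Iso.symm_hom, Iso.symm_hom,
    Ext.comp_assoc_of_second_deg_zero, Ext.comp_assoc_of_second_deg_zero, Ext.mk₀_comp_mk₀, Ext.mk₀_comp_mk₀, hψ']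

end Main

end DiscreteRep

end Literature.Algebra.Homology

end
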